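import Summits.ValiantsHypothesis.ValiantsHypothesis.Theorems.LacunarySymmetroidMatrixDescartesCensusV20SoundTwenty
import Summits.ValiantsHypothesis.ValiantsHypothesis.Theorems.LacunarySymmetroidMatrixDescartesCensusV20CoverX

/-!
# `MatrixDescartes` census — soundness of the `V = 20` certificate checker: the cover by slices with an exception list

HONEST FRAMING.  Object-search cell `pub-symmetroid`; door-A item `DoorA26 = PosRootLawAt 2 6 19`
(stmt-ValiantsHypothesis-19979; OPEN, typed, never asserted).  `V20.box_of_planX`: if a slice plan exhausts the tops
`lo ≤ d₅ ≤ N`, every slice passes the cover check with exception list `exc` against the keys, and every key carries the row `ζ ≤ 19`,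
then every sorted support `0 = d₀ < ⋯ < d₅`, `lo ≤ d₅ ≤ N`, OUTSIDE `exc` carries it (companion of `V20.box_of_plan`,
`…CensusV20SoundTwenty`).  Nothing here bears on `V = 19`, on `ζ_sym(2,6)` over all supports, on `DoorA26` itself, on
`MatrixDescartes` (stmt-ValiantsHypothesis-18050) or on `VP ≠ VNP`.

[folklore] Certificate-checker soundness; elementary.
-/

-- the D-0017 layout repeats a namespace component (single-conjunct summit); the `dupNamespace` linter flags it; name mandated.
set_option linter.dupNamespace false

namespace Summit.ValiantsHypothesis.ValiantsHypothesis.Theorems.LacunarySymmetroidMatrixDescartes.Census.V20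

open Summit.ValiantsHypothesis.ValiantsHypothesis.Theorems.MatrixDescartes.Negative (PosRootLawAt)

/-- `coverSlicesX` of a concatenated plan. [folklore] -/
theorem coverSlicesX_append (exc keys : List (List ℕ)) (A B : List (ℕ × ℕ × ℕ)) :
    coverSlicesX exc keys (A ++ B) = (coverSlicesX exc keys A && coverSlicesX exc keys B) := by
  unfold coverSlicesX; rw [List.all_append]

/-- **Soundness of the cover by slices with an exception list.** [folklore] -/
theorem box_of_planX (lo N : ℕ) (P : List (ℕ × ℕ × ℕ)) (exc keys : List (List ℕ)) (hplan : planCoversR lo N P = true)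
    (hslices : coverSlicesX exc keys P = true) (hkeys : ∀ dl ∈ keys, PosRootLawOn 2 6 19 (fun i => dl.getD i 0))
    (d : Fin 6 → ℕ) (hd : StrictMono d) (h0 : d 0 = 0) (hlo : lo ≤ d 5) (hN : d 5 ≤ N)
    (hexc : [d 0, d 1, d 2, d 3, d 4, d 5] ∉ exc) : PosRootLawOn 2 6 19 d := by
  have hdf : (fun i : Fin 6 => [d 0, d 1, d 2, d 3, d 4, d 5].getD i 0) = d := by
    funext i; fin_cases i <;> rfl
  have h34 := hd (show (3 : Fin 6) < 4 by decide)
  have h23 := hd (show (2 : Fin 6) < 3 by decide)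
  have h12 := hd (show (1 : Fin 6) < 2 by decide)
  have h01 := hd (show (0 : Fin 6) < 1 by decide)
  have h45 := hd (show (4 : Fin 6) < 5 by decide)
  unfold planCoversR at hplan
  rw [List.all_eq_true] at hplan
  have hf := hplan (d 5) (List.mem_range'_1.2 ⟨hlo, by omega⟩)
  rw [List.all_eq_true] at hf
  have he := hf (d 4) (List.mem_range.2 h45)
  have h4 : Nat.ble 4 (d 4) = true := by simp only [Nat.ble_eq]; omega
  rw [h4, Bool.not_true, Bool.false_or, List.any_eq_true] at he
  obtain ⟨s, hs, hsb⟩ := he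
  simp only [Bool.and_eq_true, beq_iff_eq, Nat.ble_eq] at hsb
  obtain ⟨⟨hs1, hs2⟩, hs3⟩ := hsb
  unfold coverSlicesX at hslices
  rw [List.all_eq_true] at hslices
  have hsl := hslices s hs
  unfold coverSliceX at hsl
  rw [List.all_eq_true] at hsl
  have hrw := hsl (d 4) (List.mem_range'_1.2 ⟨hs2, by omega⟩)
  unfold coverRowX at hrw
  rw [List.all_eq_true] at hrw
  have h := hrw _ (mem_incLists_three d hd h0)
  unfold coverCellX coverCell at h
  rw [hs1] at h
  have hl : (0 :: ([d 1, d 2, d 3] ++ [d 4, d 5])) = [d 0, d 1, d 2, d 3, d 4, d 5] := by rw [h0]; rfl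
  rw [hl] at h
  simp only [Bool.or_eq_true, Bool.not_eq_true'] at h
  rcases h with hx | ((hsid | hk) | hm)
  · exact absurd (List.elem_iff.1 hx) hexc
  · exact posRootLawOn_of_not_sidon d hsid
  · rw [← hdf]
    exact hkeys _ (List.mem_of_mem_filter (List.mem_of_mem_filter (List.elem_iff.1 hk)))
  · have hrow := hkeys _ (List.mem_of_mem_filter (List.mem_of_mem_filter (List.elem_iff.1 hm)))
    rw [mirror_six] at hrow
    exact (posRootLawOn_iff_mirror_rev d (d 5) (fun l => hd.monotone (Fin.le_last l))).2 hrow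

end Summit.ValiantsHypothesis.ValiantsHypothesis.Theorems.LacunarySymmetroidMatrixDescartes.Census.V20
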